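import Literature.ModelTheory.Zilber.EACDensityAligned
import Summits.Schanuel.Schanuel.Theorems.ZilberEacDensityRealSlopeLemmas
import HarnessLib

/-!
# Graph base × arbitrary curve, I: zero persistence, growth bookkeeping, the local coordinate

HONEST FRAMING.  Cell `pub-schanuel` (Zilber's Exponential-Algebraic Closedness, case ladder;
host summit Schanuel), seat 2, gen 16.  First of the files proving that the split surfaces
`{x₁ = p(x₀)} × Z(P)` — graph base of degree `≥ 2`, `P ∈ ℂ[y₀, y₁]` an ARBITRARY irreducible
polynomial which is not a polynomial in `y₀` alone — have Zariski-dense exponential points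
(`ZilberEacGraphCurveDensity`), an instance class of Mantova–Masser's OPEN density question
(PLMS 2024, §1 p. 5).  NOT Schanuel's conjecture (neither used nor implied; EAC ⇏ SC);
`EC(3,2)` stays OPEN.

Contents (tools for the escape engine `ZilberEacGraphCurveEscape.exists_escape_zeros`):
* Part A — `eventually_exists_zero_of_unif_approx`: Hurwitz-type persistence of a zero of an
  entire `h ≢ 0` under uniform approximation by entire `G_k` on a closed disc (from the
  minimum-modulus zero lemma `exists_zero_of_norm_lt_of_sphere` and `exists_sphere_norm_le` of
  `ZilberEacDensityRealSlopeLemmas`).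
* Part B — growth bookkeeping: `x / log(c + d x) → ∞`; linear escape in a left sector gives the
  hypothesis `|Re z_k| / log(2 + ‖z_k‖) → ∞` of `unprojectedDense_of_growth`.
* Part C — the local coordinate `φ(u) = z₀ e^{u/(dT')}` (`T' = a z₀^d`; written out explicitly,
  no definitions) around a large point `z₀` of a polynomial `R` of degree `d ≥ 2`:
  `R(φ u) = R(z₀) + u + Rem(u)` with `‖φ u - z₀‖ ≤ 1` and `‖Rem(u)‖ ≤ K/‖z₀‖` on `‖u‖ ≤ 1`
  (second-order exponential remainder of the leading monomial, which transforms EXACTLY, plus the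
  Lipschitz bound `norm_eval_sub_eval_le` of `EACDensityAligned` for the lower-order part).
-/

noncomputable section

open Filter Topology Metric Set Complex Polynomial
open Literature.ModelTheory.Zilber

set_option linter.dupNamespace false

namespace Summit.Schanuel.Schanuel.Theorems

/-! ## Part A. Persistence of a zero under uniform approximation (Hurwitz via minimum modulus) -/

/-- **Zero persistence along a sequence.**  If `h` is entire, `h ≢ 0`, `h(x₀) = 0`, and entire
functions `G_k` approximate `h` uniformly on `closedBall x₀ ε` in the limit `k → ∞`, then for all
large `k` the function `G_k` has a zero in `ball x₀ ε`. (new) -/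
theorem eventually_exists_zero_of_unif_approx {h : ℂ → ℂ} (hh : Differentiable ℂ h)
    (hne : ∃ z, h z ≠ 0) {x₀ : ℂ} (hx₀ : h x₀ = 0) {G : ℕ → ℂ → ℂ}
    (hG : ∀ k, Differentiable ℂ (G k)) {ε : ℝ} (hε : 0 < ε)
    (hunif : ∀ η : ℝ, 0 < η → ∀ᶠ k in atTop, ∀ u ∈ closedBall x₀ ε, ‖G k u - h u‖ < η) :
    ∀ᶠ k in atTop, ∃ u ∈ ball x₀ ε, G k u = 0 := by
  obtain ⟨r, hr0, hrε, m, hm0, hm⟩ := exists_sphere_norm_le hh hne x₀ hε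
  filter_upwards [hunif (m / 2) (half_pos hm0)] with k hk
  have hsph : ∀ z ∈ sphere x₀ r, m / 2 ≤ ‖G k z‖ := by
    intro z hz
    have hzB : z ∈ closedBall x₀ ε :=
      mem_closedBall.2 ((mem_sphere.1 hz).le.trans hrε)
    have h1 := hk z hzB
    have h2 := hm z hz
    have h3 := norm_sub_norm_le (h z) (G k z)
    rw [norm_sub_rev] at h3
    linarith
  have hcentre : ‖G k x₀‖ < m / 2 := by
    have h1 := hk x₀ (mem_closedBall_self hε.le)
    rwa [hx₀, sub_zero] at h1
  obtain ⟨u, hu, hu0⟩ := exists_zero_of_norm_lt_of_sphere hr0 (lt_add_one r)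
    (hG k).differentiableOn hsph hcentre
  exact ⟨u, ball_subset_ball hrε hu, hu0⟩

/-! ## Part B. Growth bookkeeping -/

/-- `x / log (c + d x) → ∞` as `x → ∞` (`c > 1`, `d > 0`). [folklore] -/
theorem gce_tendsto_div_log_affine {c d : ℝ} (hc : 1 < c) (hd : 0 < d) :
    Tendsto (fun x : ℝ => x / Real.log (c + d * x)) atTop atTop := by
  have h1 := Real.tendsto_pow_log_div_mul_add_atTop (1 / d) (-(c / d)) 1 (by positivity)
  have h2 : Tendsto (fun x : ℝ => c + d * x) atTop atTop :=
    tendsto_atTop_add_const_left _ _ (Tendsto.const_mul_atTop hd tendsto_id)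
  have h3 : Tendsto (fun x : ℝ => Real.log (c + d * x) / x) atTop (𝓝 0) := by
    refine (h1.comp h2).congr' ?_
    filter_upwards [eventually_gt_atTop 0] with x hx
    simp only [Function.comp_apply, pow_one]
    congr 1
    field_simp
    ring
  have hpos : ∀ᶠ x : ℝ in atTop, 0 < Real.log (c + d * x) / x := by
    filter_upwards [eventually_gt_atTop 0] with x hx
    exact div_pos (Real.log_pos (by nlinarith)) hx
  have h4 := (tendsto_nhdsWithin_iff.2 ⟨h3, hpos⟩).inv_tendsto_nhdsGT_zero
  refine h4.congr fun x => ?_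
  simp only [Pi.inv_apply, inv_div]

/-- **Linear escape in a left sector gives the growth condition of `unprojectedDense_of_growth`.**
If `Re z_k ≤ -L_k`, `‖z_k‖ ≤ 16 L_k + 17` and `L_k → ∞` then `|Re z_k| / log(2 + ‖z_k‖) → ∞`. (new) -/
theorem tendsto_abs_re_div_log_of_linear {z : ℕ → ℂ} {L : ℕ → ℝ} (hL : Tendsto L atTop atTop)
    (hre : ∀ k, (z k).re ≤ -L k) (hnorm : ∀ k, ‖z k‖ ≤ 16 * L k + 17) :
    Tendsto (fun k => |(z k).re| / Real.log (2 + ‖z k‖)) atTop atTop := by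
  have h1 : Tendsto (fun k => L k / Real.log (19 + 16 * L k)) atTop atTop :=
    (gce_tendsto_div_log_affine (by norm_num : (1 : ℝ) < 19) (by norm_num : (0 : ℝ) < 16)).comp hL
  refine tendsto_atTop_mono' atTop ?_ h1
  filter_upwards [hL.eventually_ge_atTop 0] with k hk
  have hlogz : 0 < Real.log (2 + ‖z k‖) := Real.log_pos (by linarith [norm_nonneg (z k)])
  have hlog19 : Real.log (2 + ‖z k‖) ≤ Real.log (19 + 16 * L k) :=
    Real.log_le_log (by linarith [norm_nonneg (z k)]) (by linarith [hnorm k])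
  have habs : L k ≤ |(z k).re| := by
    have := hre k
    rw [abs_of_nonpos (by linarith)]
    linarith
  calc L k / Real.log (19 + 16 * L k) ≤ L k / Real.log (2 + ‖z k‖) :=
        div_le_div_of_nonneg_left hk hlogz hlog19
    _ ≤ |(z k).re| / Real.log (2 + ‖z k‖) := div_le_div_of_nonneg_right habs hlogz.le

/-! ## Part C. The local coordinate `z = z₀ e^{u/(dT')}` around a large point `z₀`

No definitions are introduced: the local coordinate is the explicit expression
`φ(u) = z₀ · exp (u / (d · (a z₀^d)))` (`d = deg R`, `a` the leading coefficient, `T' = a z₀^d`),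
and the remainder is `Rem(u) = R(φ u) - R(z₀) - u`. -/

section Local

variable {R : Polynomial ℂ} {z₀ : ℂ}

/-- `φ(u) = z₀ e^{u/(dT')}` is entire in `u`. -/
theorem differentiable_gcePhi (R : Polynomial ℂ) (z₀ : ℂ) : Differentiable ℂ fun u : ℂ =>
    z₀ * exp (u / ((R.natDegree : ℂ) * (R.leadingCoeff * z₀ ^ R.natDegree))) :=
  (differentiable_const _).mul ((differentiable_id.div_const _).cexp)

/-- The leading monomial transforms exactly: `a φ(u)^d = T' e^{u/T'}` (`d ≠ 0`). -/
theorem leadingCoeff_mul_gcePhi_pow (hd : R.natDegree ≠ 0) (u : ℂ) :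
    R.leadingCoeff * (z₀ * exp (u / ((R.natDegree : ℂ) * (R.leadingCoeff * z₀ ^ R.natDegree)))) ^
        R.natDegree =
      (R.leadingCoeff * z₀ ^ R.natDegree) * exp (u / (R.leadingCoeff * z₀ ^ R.natDegree)) := by
  have hdC : (R.natDegree : ℂ) ≠ 0 := Nat.cast_ne_zero.2 hd
  rw [mul_pow, ← Complex.exp_nat_mul]
  have : (R.natDegree : ℂ) * (u / ((R.natDegree : ℂ) * (R.leadingCoeff * z₀ ^ R.natDegree))) =
      u / (R.leadingCoeff * z₀ ^ R.natDegree) := by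
    field_simp
  rw [this]; ring

/-- **The remainder splits** into the second-order exponential remainder of the leading monomial
and the variation of the lower-order part `ℓ = R.eraseLead`:
`Rem(u) = T'(e^{u/T'} - 1 - u/T') + (ℓ(φ u) - ℓ(z₀))` (`T' = a z₀^d ≠ 0`). -/
theorem gceRem_eq (hd : R.natDegree ≠ 0) (hT : R.leadingCoeff * z₀ ^ R.natDegree ≠ 0) (u : ℂ) :
    R.eval (z₀ * exp (u / ((R.natDegree : ℂ) * (R.leadingCoeff * z₀ ^ R.natDegree)))) -
        R.eval z₀ - u =
      (R.leadingCoeff * z₀ ^ R.natDegree) *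
          (exp (u / (R.leadingCoeff * z₀ ^ R.natDegree)) - 1 -
            u / (R.leadingCoeff * z₀ ^ R.natDegree)) +
        (R.eraseLead.eval (z₀ * exp (u / ((R.natDegree : ℂ) * (R.leadingCoeff * z₀ ^ R.natDegree)))) -
          R.eraseLead.eval z₀) := by
  rw [eval_eq_eraseLead_add R (z₀ * exp _), eval_eq_eraseLead_add R z₀,
    leadingCoeff_mul_gcePhi_pow hd]
  have : R.leadingCoeff * z₀ ^ R.natDegree * (u / (R.leadingCoeff * z₀ ^ R.natDegree)) = u :=
    mul_div_cancel₀ u hT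
  rw [mul_sub, mul_sub, this]
  ring

/-- **Displacement bound**: for `‖z₀‖ ≥ 1`, `‖a‖ ‖z₀‖ ≥ 2` and `‖u‖ ≤ 1`,
`‖φ(u) - z₀‖ ≤ 2 / (‖a‖ ‖z₀‖^{d-1}) ≤ 1` (`d ≥ 2`). -/
theorem norm_gcePhi_sub_le (hd : 2 ≤ R.natDegree) (hz : 1 ≤ ‖z₀‖)
    (haz : 2 ≤ ‖R.leadingCoeff‖ * ‖z₀‖) {u : ℂ} (hu : ‖u‖ ≤ 1) :
    ‖z₀ * exp (u / ((R.natDegree : ℂ) * (R.leadingCoeff * z₀ ^ R.natDegree))) - z₀‖ ≤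
        2 / (‖R.leadingCoeff‖ * ‖z₀‖ ^ (R.natDegree - 1)) ∧
      2 / (‖R.leadingCoeff‖ * ‖z₀‖ ^ (R.natDegree - 1)) ≤ 1 := by
  -- the exponent `w = u/(d T')` is small
  set w : ℂ := u / ((R.natDegree : ℂ) * (R.leadingCoeff * z₀ ^ R.natDegree)) with hw
  set d := R.natDegree with hd_def
  set a := R.leadingCoeff with ha_def
  have hz0 : 0 < ‖z₀‖ := by linarith
  have hapos : 0 < ‖a‖ := by
    rcases (norm_nonneg a).eq_or_lt with h | h
    · rw [← h, zero_mul] at haz; linarith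
    · exact h
  have hd1 : 1 ≤ d - 1 := by omega
  have hpow1 : ‖z₀‖ ≤ ‖z₀‖ ^ (d - 1) := by
    calc ‖z₀‖ = ‖z₀‖ ^ 1 := (pow_one _).symm
      _ ≤ ‖z₀‖ ^ (d - 1) := pow_le_pow_right₀ hz hd1
  have hden : 2 ≤ ‖a‖ * ‖z₀‖ ^ (d - 1) := haz.trans (mul_le_mul_of_nonneg_left hpow1 hapos.le)
  have hdenpos : 0 < ‖a‖ * ‖z₀‖ ^ (d - 1) := by linarith
  have hTd : ‖a‖ * ‖z₀‖ ^ d = ‖a‖ * ‖z₀‖ ^ (d - 1) * ‖z₀‖ := by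
    have : d = d - 1 + 1 := by omega
    conv_lhs => rw [this, pow_succ]
    ring
  have hdR : (1 : ℝ) ≤ d := by exact_mod_cast (show 1 ≤ d by omega)
  have hwnorm : ‖w‖ = ‖u‖ / (d * (‖a‖ * ‖z₀‖ ^ d)) := by
    rw [hw, norm_div, norm_mul, Complex.norm_natCast, norm_mul, norm_pow]
  have hTpos : 0 < (d : ℝ) * (‖a‖ * ‖z₀‖ ^ d) := by rw [hTd]; positivity
  have hw1 : ‖w‖ ≤ 1 / (‖a‖ * ‖z₀‖ ^ (d - 1) * ‖z₀‖) := by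
    rw [hwnorm, hTd]
    calc ‖u‖ / (d * (‖a‖ * ‖z₀‖ ^ (d - 1) * ‖z₀‖)) ≤ 1 / (d * (‖a‖ * ‖z₀‖ ^ (d - 1) * ‖z₀‖)) :=
          div_le_div_of_nonneg_right hu (by rw [← hTd]; exact hTpos.le)
      _ ≤ 1 / (‖a‖ * ‖z₀‖ ^ (d - 1) * ‖z₀‖) := by
          apply div_le_div_of_nonneg_left zero_le_one (by positivity)
          calc ‖a‖ * ‖z₀‖ ^ (d - 1) * ‖z₀‖ = 1 * (‖a‖ * ‖z₀‖ ^ (d - 1) * ‖z₀‖) := (one_mul _).symm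
            _ ≤ d * (‖a‖ * ‖z₀‖ ^ (d - 1) * ‖z₀‖) :=
                mul_le_mul_of_nonneg_right hdR (by positivity)
  have hw1' : ‖w‖ ≤ 1 := by
    refine hw1.trans ?_
    rw [div_le_one (by positivity)]
    nlinarith
  have hexp : ‖exp w - 1‖ ≤ 2 * ‖w‖ := Complex.norm_exp_sub_one_le hw1'
  have hdiff : z₀ * exp w - z₀ = z₀ * (exp w - 1) := by ring
  constructor
  · rw [hdiff, norm_mul]
    calc ‖z₀‖ * ‖exp w - 1‖ ≤ ‖z₀‖ * (2 * (1 / (‖a‖ * ‖z₀‖ ^ (d - 1) * ‖z₀‖))) :=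
          mul_le_mul_of_nonneg_left (hexp.trans (by linarith)) (norm_nonneg _)
      _ = 2 / (‖a‖ * ‖z₀‖ ^ (d - 1)) := by field_simp
  · rw [div_le_one hdenpos]; exact hden

/-- **Remainder bound**: for `‖z₀‖ ≥ 1`, `‖a‖‖z₀‖ ≥ 2`, `‖u‖ ≤ 1` one has `‖Rem(u)‖ ≤ K / ‖z₀‖` with
`K = 1/‖a‖ + (Σ‖ℓᵢ‖)(d-1) 2^{d-1}/‖a‖` independent of `z₀` and `u`. -/
theorem norm_gceRem_le (hd : 2 ≤ R.natDegree) (hz : 1 ≤ ‖z₀‖)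
    (haz : 2 ≤ ‖R.leadingCoeff‖ * ‖z₀‖) {u : ℂ} (hu : ‖u‖ ≤ 1) :
    ‖R.eval (z₀ * exp (u / ((R.natDegree : ℂ) * (R.leadingCoeff * z₀ ^ R.natDegree)))) -
        R.eval z₀ - u‖ ≤
      (1 / ‖R.leadingCoeff‖ + coeffNormSum R.eraseLead * ((R.natDegree - 1 : ℕ) : ℝ) *
        2 ^ (R.natDegree - 1) / ‖R.leadingCoeff‖) / ‖z₀‖ := by
  have hz0 : 0 < ‖z₀‖ := by linarith
  have hapos : 0 < ‖R.leadingCoeff‖ := by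
    rcases (norm_nonneg R.leadingCoeff).eq_or_lt with h | h
    · rw [← h, zero_mul] at haz; linarith
    · exact h
  have hT0 : R.leadingCoeff * z₀ ^ R.natDegree ≠ 0 :=
    mul_ne_zero (norm_pos_iff.1 hapos) (pow_ne_zero _ (norm_pos_iff.1 hz0))
  obtain ⟨hdisp, hdisp1⟩ := norm_gcePhi_sub_le hd hz haz hu
  rw [gceRem_eq (by omega) hT0]
  -- abbreviations
  set φu : ℂ := z₀ * exp (u / ((R.natDegree : ℂ) * (R.leadingCoeff * z₀ ^ R.natDegree))) with hφu
  set T : ℂ := R.leadingCoeff * z₀ ^ R.natDegree with hT_def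
  set d := R.natDegree with hd_def
  set a := R.leadingCoeff with ha_def
  set ℓ := R.eraseLead with hℓ_def
  have hTnorm : ‖T‖ = ‖a‖ * ‖z₀‖ ^ d := by rw [hT_def, norm_mul, norm_pow]
  have hpowd : ‖z₀‖ ≤ ‖z₀‖ ^ d := by
    calc ‖z₀‖ = ‖z₀‖ ^ 1 := (pow_one _).symm
      _ ≤ ‖z₀‖ ^ d := pow_le_pow_right₀ hz (by omega)
  have hT2 : 2 ≤ ‖T‖ := by
    rw [hTnorm]; exact haz.trans (mul_le_mul_of_nonneg_left hpowd hapos.le)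
  have hTpos : 0 < ‖T‖ := by linarith
  -- (1) the exponential remainder
  have h1 : ‖T * (exp (u / T) - 1 - u / T)‖ ≤ 1 / (‖a‖ * ‖z₀‖) := by
    have hv : ‖u / T‖ ≤ 1 := by
      rw [norm_div, div_le_one hTpos]; linarith
    have hv2 := Complex.norm_exp_sub_one_sub_id_le hv
    rw [norm_mul]
    calc ‖T‖ * ‖exp (u / T) - 1 - u / T‖
        ≤ ‖T‖ * ‖u / T‖ ^ 2 := mul_le_mul_of_nonneg_left hv2 (norm_nonneg _)
      _ = ‖u‖ ^ 2 / ‖T‖ := by rw [norm_div]; field_simp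
      _ ≤ 1 / ‖T‖ := by
          apply div_le_div_of_nonneg_right _ hTpos.le
          nlinarith [norm_nonneg u]
      _ ≤ 1 / (‖a‖ * ‖z₀‖) := by
          rw [hTnorm]
          exact div_le_div_of_nonneg_left zero_le_one (by positivity)
            (mul_le_mul_of_nonneg_left hpowd hapos.le)
  -- (2) the lower-order part
  have hℓdeg : ℓ.natDegree ≤ (d - 2) + 1 := by
    have := Polynomial.eraseLead_natDegree_le R
    rw [← hℓ_def, ← hd_def] at this; omega
  have hM : (1 : ℝ) ≤ 2 * ‖z₀‖ := by linarith
  have hφM : ‖φu‖ ≤ 2 * ‖z₀‖ := by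
    have := norm_le_insert' φu z₀
    linarith [hdisp.trans hdisp1]
  have hz₀M : ‖z₀‖ ≤ 2 * ‖z₀‖ := by linarith
  have h2 := norm_eval_sub_eval_le ℓ hM hφM hz₀M hℓdeg
  have h2' : ‖ℓ.eval φu - ℓ.eval z₀‖ ≤
      coeffNormSum ℓ * ((d - 1 : ℕ) : ℝ) * 2 ^ (d - 1) / ‖a‖ / ‖z₀‖ := by
    refine h2.trans ?_
    have hcast : ((d - 2 : ℕ) : ℝ) + 1 = ((d - 1 : ℕ) : ℝ) := by
      have : d - 1 = d - 2 + 1 := by omega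
      rw [this]; push_cast; ring
    rw [hcast]
    calc coeffNormSum ℓ * ((d - 1 : ℕ) : ℝ) * (2 * ‖z₀‖) ^ (d - 2) * ‖φu - z₀‖
        ≤ coeffNormSum ℓ * ((d - 1 : ℕ) : ℝ) * (2 * ‖z₀‖) ^ (d - 2) *
            (2 / (‖a‖ * ‖z₀‖ ^ (d - 1))) :=
          mul_le_mul_of_nonneg_left hdisp (by
            have := coeffNormSum_nonneg ℓ; positivity)
      _ = coeffNormSum ℓ * ((d - 1 : ℕ) : ℝ) * 2 ^ (d - 1) / ‖a‖ / ‖z₀‖ := by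
          have hd1 : d - 1 = d - 2 + 1 := by omega
          rw [mul_pow, hd1, pow_succ, pow_succ]
          field_simp
  -- assemble
  calc ‖T * (exp (u / T) - 1 - u / T) + (ℓ.eval φu - ℓ.eval z₀)‖
      ≤ 1 / (‖a‖ * ‖z₀‖) + coeffNormSum ℓ * ((d - 1 : ℕ) : ℝ) * 2 ^ (d - 1) / ‖a‖ / ‖z₀‖ :=
        (norm_add_le _ _).trans (add_le_add h1 h2')
    _ = (1 / ‖a‖ + coeffNormSum ℓ * ((d - 1 : ℕ) : ℝ) * 2 ^ (d - 1) / ‖a‖) / ‖z₀‖ := by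
        field_simp

end Local

end Summit.Schanuel.Schanuel.Theorems
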